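import Literature.AnabelianGeometry.EtaleTheta.DivisorMonoidsOfGaloisCoveringTempered
import Literature.AnabelianGeometry.EtaleTheta.TemperedFrobenioidOfRankOneBase
import Literature.AnabelianGeometry.EtaleTheta.TemperedFrobenioidOfGaloisCoveringOneComponent
import Literature.AnabelianGeometry.EtaleTheta.BiKummerThm44SubModelConnectedBaseInjWeak
import Literature.AnabelianGeometry.EtaleTheta.Discharge.Sec5OfConnectedTemperoid
import Literature.AlgebraicGeometry.Frobenioids.QuasiTemperoidConnectedPart
import HarnessLib

/-!
# [EtTh] Thm. 4.4: the hypothesis record `Thm44Hyp` INHABITED at CONSTRUCTED data over the genuine connected base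
# `B^temp(Π^tp_X)⁰` — the tempered-base model (class (b) NV; repair of the kernel finding F-w6d048g3-2)

S. Mochizuki, *The étale theta function …*, Publ. RIMS **45** (2009) [MochizukiEtTh2009], Def. 3.3 (iii) p.73, Def. 3.6 (ii)
p.76–77, Def. 4.1 p.86–87, Thm. 4.4 p.93–95 [cite: MochizukiEtTh2009, Thm 4.4 p.93]; [SemiAnbd] Rmk. 3.1.2 p.33; [FrdII] Ex. 1.3.

abc-iut cell, block C / W6, seat abc-iut-w6-d048 (gen 3); L2-lead R398 (2026-08-26T13:14Z).  KERNEL FINDING F-w6d048g3-2 (this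
seat, accepted R398): every tempered Frobenioid over the constructed Def. 3.3 (iii) data of record so far has either a CONSTANT
base functor (rank-one witnesses) or reads its data over `G`-set models admitting non-open stabilisers, so
`BiKummerSetting.Thm44Hyp.baseShape` («`D_i := B^temp(X_i^log)[𝒟_i]`»: base functor full, faithful, essential image = the
objects over some `𝒟`) was never witnessed at constructed data and abc-iut-w5-d179's «Thm 4.4 ⇐ {hBD₁, hBD₂, T44-L15b} at
the genuine connected base» was VACUOUS there.  THIS FILE LIFTS IT: for EVERY tempered arithmetic group `X` (field `K : Type`),
every open normal `M ⊴ Π^tp_X` and every `(N, H)`-slot `NH`: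
* Def. 3.3 (iii) data := `DivisorMonoids.ofGaloisActionCosetCat X.isTempered (trivial action of Π^tp_X on the one-component
  model Z_∞ = X) _` over the SMALL model `CosetCat Π^tp_X ≌ B^temp(Π^tp_X)⁰` of print's `D₀` (open subgroups only);
* `OneCompTrivFrd.*` — under the trivial action every connected covering `S` has `Φ₀(S) = Hom_Π(S, ℤ_{≥0}·[F]) ≅ ℤ_{≥0}`
  (equivariant maps out of ONE orbit into a trivial target are constant), every effective log-divisor is the divisor of a
  constant function `u·ϖⁿ`, and endomorphisms of `S` pull `Φ₀(S)` back identically;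
* `OneCompTempered.temperedFrobenioid X R S` — this seat's engine `TemperedFrobenioid.ofRankOneBase` with base functor
  `(CosetCat.equivConnectedPart X.isTempered).inverse : B^temp(Π^tp_X)⁰ ⥤ CosetCat Π^tp_X` (an EQUIVALENCE: full, faithful,
  essentially surjective), `Φ := im(Φ₀^pf → Φ₀^rlf)` objectwise; it IS a Frobenioid (`isFrobenioid_temperedFrobenioid`);
* `OneCompTempered.setting X R S NH M := BiKummerSetting.mkOfConnectedTemperoid X (temperedFrobenioid X R S) rfl hP NH (Π^tp_X/M, 0) …`
  (abc-iut-L2-t4's genuine §4 setting; `A_⊙ := connQuotZeroObj M`);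
* **`OneCompTempered.thm44Hyp X R S NH M : Thm44Hyp (setting …) (setting …)`** — the identity self-equivalence: `Φ` non-dilating
  (pull-backs along endomorphisms are the identity), **`baseShape` with `𝒟 := CosetCat.top`** (every open subgroup maps to
  `Π^tp_X`), `H_⊙` open (abc-iut-L2-t4's `isOpen_Hodot_mkOfConnectedTemperoid`), `comm` by unitors, `Ψ^bs(A_⊙^bs) ≅ A_⊙^bs`;
* FIRING abc-iut-w5-d179's closers BY NAME: `thm44_i_oneCompTempered`, `thm44_oneCompTempered` ((i) ∧ (ii) ∧ (iii) ∧ N-th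
  roots ⇐ {hBD₁, hBD₂, T44-L15b}, all three discharged here), `thm44_rootsReading_oneCompTempered` — NON-VACUOUSLY.
HONEST FRAMING: a degenerate but legitimate instance (trivial Galois action on a one-component log-divisor model: rank one at
every covering); it certifies joint satisfiability of the typed hypotheses at constructed data, nothing about the intended
arithmetic instances; `LogDivisorModel` / `GaloisAction` / `TemperedArithmeticGroup` are interface records; no named Prop fact,
no instance, no sorry; nothing here bears on [IUTchIII] Cor. 3.12; typed ≠ proved.
-/

noncomputable section

namespace Literature.AnabelianGeometry.EtaleTheta

open CategoryTheory Opposite Function Literature.AlgebraicGeometry.Frobenioids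
  Literature.AnabelianGeometry.SemiGraphs LogDivisorModel LogDivisorModel.GaloisAction

/-! ## §1 The trivial action of an arbitrary group on the one-component model: `Φ₀(S) ≅ ℤ_{≥0}` for connected `S` -/

namespace OneCompTrivFrd

variable (U : Type) [CommGroup U] (hU : ∀ u : U, (∀ N : ℕ+, ∃ g : U, g ^ (N : ℕ) = u) → u = 1) (Γ : Type) [Group Γ]

/-- The trivial action of `Γ` on the one-component model `Z_∞` (`Gal(Z_∞/X)` acting through `1`). [cite: MochizukiEtTh2009, Def 3.3 p.73] -/
abbrev act : (oneComp U hU).GaloisAction Γ := GaloisAction.trivial (oneComp U hU) Γ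

variable {U hU Γ}

/-- An equivariant map from ONE orbit to a trivially acted-on target is constant. [cite: MochizukiEtTh2009, Rmk 3.3.1 p.73] -/
theorem apply_eq_apply {S : Action (Type 0) Γ} (hS : isConnectedGSet S) (φ : (act U hU Γ).phiZero S) (s t : S.V) :
    φ.1 s = φ.1 t := by
  obtain ⟨g, hg⟩ := hS.2 t s
  rw [← hg]
  exact φ.2.2 g t

variable (U hU Γ)

/-- The multiplicity along `F` of `φ ∈ Φ₀(S)` (at any point — `φ` is constant). [cite: MochizukiEtTh2009, Rmk 3.3.1 p.73] -/
def multAt {S : Action (Type 0) Γ} (hS : isConnectedGSet S) (φ : (act U hU Γ).phiZero S) : ℕ :=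
  Int.toNat (OneComp.val (φ.1 hS.1.some))

/-- `multAt` recovers the value at EVERY point as the log-divisor `n·[F]`. [cite: MochizukiEtTh2009, Rmk 3.3.1 p.73] -/
theorem ofAdd_multAt {S : Action (Type 0) Γ} (hS : isConnectedGSet S) (φ : (act U hU Γ).phiZero S) (s : S.V) :
    (Multiplicative.ofAdd ((multAt U hU Γ hS φ : ℕ) : ℤ) : (oneComp U hU).DIV) = φ.1 s := by
  have h0 : 0 ≤ OneComp.val (φ.1 s) := (φ.2.1 s).2
  rw [multAt, apply_eq_apply hS φ hS.1.some s, Int.toNat_of_nonneg h0]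
  exact ofAdd_toAdd _

/-- The constant equivariant map with value `n·[F]`, an element of `Φ₀(S)`. [cite: MochizukiEtTh2009, Def 3.3 p.73] -/
def constPhi (S : Action (Type 0) Γ) (n : ℕ) : (act U hU Γ).phiZero S :=
  ⟨fun _ => (Multiplicative.ofAdd (n : ℤ) : Multiplicative ℤ), fun _ => OneCompFrd.ofAdd_natCast_mem_Divplus U hU n, fun _ _ => rfl⟩

/-- **`Φ₀(S) ≅ ℤ_{≥0}`** for every connected `S` under the trivial action. [cite: MochizukiEtTh2009, Rmk 3.3.1 p.73] -/
def phiZeroEquivNat {S : Action (Type 0) Γ} (hS : isConnectedGSet S) : (act U hU Γ).phiZero S ≃* Multiplicative ℕ where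
  toFun φ := Multiplicative.ofAdd (multAt U hU Γ hS φ)
  invFun n := constPhi U hU Γ S (Multiplicative.toAdd n)
  left_inv φ := Subtype.ext (funext fun s => by
    show (constPhi U hU Γ S (Multiplicative.toAdd (Multiplicative.ofAdd (multAt U hU Γ hS φ)))).1 s = φ.1 s
    rw [toAdd_ofAdd]
    exact ofAdd_multAt U hU Γ hS φ s)
  right_inv n := by
    change Multiplicative.ofAdd (Int.toNat (OneComp.val (Multiplicative.ofAdd ((Multiplicative.toAdd n : ℕ) : ℤ)))) = n
    rw [OneComp.val_ofAdd, Int.toNat_natCast, ofAdd_toAdd]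
  map_mul' φ ψ := by
    rw [← ofAdd_add]
    congr 1
    have hφ : (0 : ℤ) ≤ OneComp.val (φ.1 hS.1.some) := (φ.2.1 _).2
    have hψ : (0 : ℤ) ≤ OneComp.val (ψ.1 hS.1.some) := (ψ.2.1 _).2
    change Int.toNat (OneComp.val (φ.1 hS.1.some * ψ.1 hS.1.some)) = _
    rw [show OneComp.val (φ.1 hS.1.some * ψ.1 hS.1.some) =
        OneComp.val (φ.1 hS.1.some) + OneComp.val (ψ.1 hS.1.some) from toAdd_mul _ _,
      Int.toNat_add hφ hψ]
    rfl

/-- `e⁻¹(n)` is the constant map `n·[F]`. [cite: MochizukiEtTh2009, Rmk 3.3.1 p.73] -/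
theorem phiZeroEquivNat_symm_apply {S : Action (Type 0) Γ} (hS : isConnectedGSet S) (n : Multiplicative ℕ) :
    (phiZeroEquivNat U hU Γ hS).symm n = constPhi U hU Γ S (Multiplicative.toAdd n) := rfl

/-- **Endomorphisms of a connected covering pull `Φ₀` back IDENTICALLY** (the maps are constant).
[cite: MochizukiEtTh2009, Rmk 3.3.1 p.73] -/
theorem phiZeroPull_endo_apply {S : Action (Type 0) Γ} (hS : isConnectedGSet S) (f : S ⟶ S) (φ : (act U hU Γ).phiZero S) :
    (act U hU Γ).phiZeroPull f φ = φ :=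
  Subtype.ext (funext fun _ => apply_eq_apply hS φ _ _)

/-- The constant function `u·ϖⁿ` on `S`, an element of `B₀(S) = Hom_Γ(S, Mero(Z_∞))`. [cite: MochizukiEtTh2009, Def 3.3 p.73] -/
def cnstFn (S : Action (Type 0) Γ) (u : U) (n : ℤ) : (act U hU Γ).bZero S :=
  ⟨fun _ => ((u, Multiplicative.ofAdd n) : U × Multiplicative ℤ), fun _ => trivial, fun _ _ => rfl⟩

/-- `u·ϖⁿ ∈ F₀(S)` (every function of the one-component model is constant). [cite: MochizukiEtTh2009, Def 3.3 p.73] -/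
theorem cnstFn_mem_fZero (S : Action (Type 0) Γ) (u : U) (n : ℤ) : cnstFn U hU Γ S u n ∈ (act U hU Γ).fZero S :=
  fun _ => trivial

/-- `div₀(u·ϖⁿ) = n·[F] / 1` for `n ≥ 0`. [cite: MochizukiEtTh2009, Def 3.3 p.73] -/
theorem divZeroHom_cnstFn (S : Action (Type 0) Γ) (u : U) (n : ℕ) :
    (act U hU Γ).divZeroHom S (cnstFn U hU Γ S u n) = Algebra.GrothendieckGroup.of (constPhi U hU Γ S n) :=
  (((act U hU Γ).divZeroHom_eq_div_iff _ _ (constPhi U hU Γ S n) 1).2 fun _ => mul_one _).trans (by rw [map_one, div_one])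

/-- **Every effective log-divisor over a connected covering is the divisor of a constant function** (`hcnst`).
[cite: MochizukiEtTh2009, Def 3.3 p.73] -/
theorem exists_cnst_div_eq {S : Action (Type 0) Γ} (hS : isConnectedGSet S) (m : (act U hU Γ).phiZero S) :
    ∃ b ∈ (act U hU Γ).fZero S, (act U hU Γ).divZeroHom S b = Algebra.GrothendieckGroup.of m :=
  ⟨cnstFn U hU Γ S 1 (multAt U hU Γ hS m), cnstFn_mem_fZero U hU Γ S 1 _, by
    rw [divZeroHom_cnstFn, show constPhi U hU Γ S (multAt U hU Γ hS m) = m from (phiZeroEquivNat U hU Γ hS).symm_apply_apply m]⟩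

end OneCompTrivFrd

/-! ## §2 The §4 setting over constructed data at EVERY tempered arithmetic group, with `Thm44Hyp` inhabited -/

namespace OneCompTempered

variable (U : Type) [CommGroup U] (hU : ∀ u : U, (∀ N : ℕ+, ∃ g : U, g ^ (N : ℕ) = u) → u = 1)
  {K : Type} [Field K] (X : SemiGraphs.TemperedArithmeticGroup.{0} K)

/-- The Def. 3.3 (iii) data of the model: trivial action of `Π^tp_X` on the one-component model, over the small model
`CosetCat Π^tp_X` of `B^temp(Π^tp_X)⁰`. [cite: MochizukiEtTh2009, Def 3.3 p.73] -/
abbrev dm : DivisorMonoids.{0, 0, 0} (CosetCat X.Pi) :=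
  DivisorMonoids.ofGaloisActionCosetCat X.isTempered (OneCompTrivFrd.act U hU X.Pi) (cuspLaws_oneComp U hU)

/-- Prop. 3.4 (i) (weak, cofinal perfection) at every `Φ₀(H)` — the `hpf` slot. [cite: MochizukiEtTh2009, Prop 3.4 p.74] -/
theorem hpf : ∀ Y : (CosetCat X.Pi)ᵒᵖ, IsPerfFactorialCof ((dm U hU X).Φ₀.obj Y) :=
  fun Y => DivisorMonoids.ofGaloisActionCosetCat_isPerfFactorialCof X.isTempered _ _ Y

/-- `CosetCat Π^tp_X ≌ B^temp(Π^tp_X)⁰` (abc-iut's `CosetCat.equivConnectedPart`). [cite: MochizukiFrdII2008, Ex 1.3 (i) p.11] -/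
abbrev equiv : CosetCat X.Pi ≌ ConnectedPart (BTemp X.Pi) := CosetCat.equivConnectedPart X.isTempered

/-- Every `Π^tp_X/H` (`H` open) is a connected covering (one orbit). [cite: MochizukiFrdII2008, Ex 1.3 (ii) p.11] -/
theorem isConnectedGSet_toBTemp (Y : CosetCat X.Pi) : isConnectedGSet ((CosetCat.toBTemp X.isTempered).obj Y).obj :=
  isConnectedGSet_temperedInclusion ((CosetCat.toConnected X.isTempered).obj Y)

/-- **Rank-one base data along the equivalence `B^temp(Π^tp_X)⁰ ⥤ CosetCat Π^tp_X`.** [cite: MochizukiEtTh2009, Def 3.6 p.77] -/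
def rankOneBase : TemperedFrobenioid.RankOneBase (dm U hU X) (ConnectedPart (BTemp X.Pi)) where
  F := (equiv X).inverse
  e A := OneCompTrivFrd.phiZeroEquivNat U hU X.Pi (isConnectedGSet_toBTemp X ((equiv X).inverse.obj A))
  hcnst A m := OneCompTrivFrd.exists_cnst_div_eq U hU X.Pi (isConnectedGSet_toBTemp X ((equiv X).inverse.obj A)) m
  hΦinj _ := DivisorMonoids.ofGaloisActionCosetCat_Φ₀_map_injective X.isTempered _ _ _
  hΦrefl _ a b h := DivisorMonoids.ofGaloisActionCosetCat_Φ₀_map_reflects_dvd X.isTempered _ _ _ a b h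

variable (R S : ((ConnectedPart (BTemp X.Pi))ᵒᵖ ⥤ CommMonCat.{0}) → Prop)

/-- **The tempered Frobenioid of the model over the GENUINE base `B^temp(Π^tp_X)⁰` with EQUIVALENCE base functor.**
[cite: MochizukiEtTh2009, Def 3.6 p.77] -/
def temperedFrobenioid :
    TemperedFrobenioid (RealifiedDivisorMonoids.ofRlfZWeak (dm U hU X) (hpf U hU X)) (ConnectedPart (BTemp X.Pi))
      (treeCatVocab (ConnectedPart (BTemp X.Pi)) R S) :=
  TemperedFrobenioid.ofRankOneBase (hpf U hU X) (rankOneBase U hU X) QuasiTemperoid.BTempConnected.connectedPart_isConnected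
    QuasiTemperoid.BTempConnected.connectedPart_isTotallyEpimorphic QuasiTemperoid.BTempConnected.connectedPart_isOfFSMType R S

/-- Its base functor IS the equivalence inverse `B^temp(Π^tp_X)⁰ ⥤ CosetCat Π^tp_X`. [cite: MochizukiEtTh2009, Def 3.6 p.77] -/
theorem temperedFrobenioid_base : (temperedFrobenioid U hU X R S).base = (equiv X).inverse := rfl

/-- The base functor is full. [cite: MochizukiEtTh2009, Def 4.1 p.86] -/
theorem temperedFrobenioid_base_full : (temperedFrobenioid U hU X R S).base.Full := by
  rw [temperedFrobenioid_base]; infer_instance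

/-- The base functor is faithful. [cite: MochizukiEtTh2009, Def 4.1 p.86] -/
theorem temperedFrobenioid_base_faithful : (temperedFrobenioid U hU X R S).base.Faithful := by
  rw [temperedFrobenioid_base]; infer_instance

/-- The base functor is essentially surjective. [cite: MochizukiEtTh2009, Def 4.1 p.86] -/
theorem temperedFrobenioid_base_essSurj : (temperedFrobenioid U hU X R S).base.EssSurj := by
  rw [temperedFrobenioid_base]; infer_instance

/-- **`baseShape`**: `D = D₀[𝒟]` with `𝒟 := Π^tp_X/Π^tp_X` — every object of `CosetCat Π^tp_X` is in the essential image and maps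
to `CosetCat.top`. [cite: MochizukiEtTh2009, Def 4.1 p.86] -/
theorem baseShape : (temperedFrobenioid U hU X R S).base.Full ∧ (temperedFrobenioid U hU X R S).base.Faithful ∧
    ∃ 𝒟 : CosetCat X.Pi, ∀ Y : CosetCat X.Pi,
      (∃ A : ConnectedPart (BTemp X.Pi), Nonempty ((temperedFrobenioid U hU X R S).base.obj A ≅ Y)) ↔ Nonempty (Y ⟶ 𝒟) :=
  ⟨temperedFrobenioid_base_full U hU X R S, temperedFrobenioid_base_faithful U hU X R S, CosetCat.top, fun Y =>
    ⟨fun _ => ⟨CosetCat.toTop Y⟩, fun _ => ⟨(equiv X).functor.obj Y, ⟨((equiv X).unitIso.app Y).symm⟩⟩⟩⟩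

/-- `hBD`: the `B₀`-pull-backs along base images are injective (this seat's one-liner). [cite: MochizukiEtTh2009, Def 3.6 p.76] -/
theorem hBD {A B : ConnectedPart (BTemp X.Pi)} (α : B ⟶ A) :
    Injective ((RealifiedDivisorMonoids.ofRlfZWeak (dm U hU X) (hpf U hU X)).BΛ.map
      ((temperedFrobenioid U hU X R S).base.map α).op).hom :=
  DivisorMonoids.ofGaloisActionCosetCat_B₀_map_injective X.isTempered _ _ _

/-- **The model IS a Frobenioid** ([FrdI] Thm. 5.2 (ii)). [cite: MochizukiFrdI2008, Thm. 5.2 (ii) p.100] -/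
theorem isFrobenioid_temperedFrobenioid : PreFrobenioid.IsFrobenioid (temperedFrobenioid U hU X R S).toElem :=
  TemperedFrobenioid.isFrobenioid_ofRankOneBase (hpf U hU X) (rankOneBase U hU X) _ _ _ R S
    fun g => DivisorMonoids.ofGaloisActionCosetCat_B₀_map_injective X.isTempered _ _ g

/-- **`Φ` is non-dilating along every endomorphism of the base** ([FrdI] Def. 1.1 (i); pull-backs are the identity).
[cite: MochizukiFrdI2008, Def. 1.1 (i) p.19] -/
theorem isNonDilating (A : (ConnectedPart (BTemp X.Pi))ᵒᵖ) (φ : A ⟶ A) :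
    treeMonoidVocabWeak.{0}.IsNonDilating ((temperedFrobenioid U hU X R S).Φ.carrier A)
      ((temperedFrobenioid U hU X R S).Φ.pull φ) :=
  TemperedFrobenioid.isNonDilating_ofRankOneBase_of_trivial (hpf U hU X) (rankOneBase U hU X) _ _ _ R S A φ fun m =>
    OneCompTrivFrd.phiZeroPull_endo_apply U hU X.Pi (isConnectedGSet_toBTemp X ((equiv X).inverse.obj A.unop)) _ m

/-- `Φ(A)` is perfect — the `hP` slot. [cite: MochizukiEtTh2009, Def 4.1 p.86] -/
theorem hP (A : (ConnectedPart (BTemp X.Pi))ᵒᵖ) : IsPerfect ((temperedFrobenioid U hU X R S).Φ.carrier A) :=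
  TemperedFrobenioid.ofRankOneBase_isPerfect (hpf U hU X) (rankOneBase U hU X) _ _ _ R S A

variable (NH : Subgroup (Field.absoluteGaloisGroup K) → (temperedFrobenioid U hU X R S).category → ℕ+ → Prop)
  (M : OpenNormalSubgroup X.Pi)

/-- **The §4 bi-Kummer setting over CONSTRUCTED data at the genuine connected base** (abc-iut-L2-t4's
`mkOfConnectedTemperoid`; `A_⊙ := (Π^tp_X/M, 0)`). [cite: MochizukiEtTh2009, Def 4.1 p.86] -/
def setting : BiKummerSetting X (RealifiedDivisorMonoids.ofRlfZWeak (dm U hU X) (hpf U hU X)) (ConnectedPart (BTemp X.Pi))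
    (treeCatVocab (ConnectedPart (BTemp X.Pi)) R S) :=
  BiKummerSetting.mkOfConnectedTemperoid X (temperedFrobenioid U hU X R S) rfl (hP U hU X R S) NH
    ((temperedFrobenioid U hU X R S).connQuotZeroObj M) ((temperedFrobenioid U hU X R S).isFrobeniusTrivial_connQuotZeroObj M)
    ((temperedFrobenioid U hU X R S).isGaloisObj_connQuotZeroObj_base M)

/-- **`Thm44Hyp` INHABITED at constructed data over `B^temp(Π^tp_X)⁰`**: the identity self-equivalence.
[cite: MochizukiEtTh2009, Thm 4.4 p.93] -/
def thm44Hyp : BiKummerSetting.Thm44Hyp (setting U hU X R S NH M) (setting U hU X R S NH M) where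
  isNonDilating₁ A φ := isNonDilating U hU X R S A φ
  isNonDilating₂ A φ := isNonDilating U hU X R S A φ
  baseShape₁ := baseShape U hU X R S
  baseShape₂ := baseShape U hU X R S
  isOpen_Hodot₁ := BiKummerSetting.isOpen_Hodot_mkOfConnectedTemperoid X _ _ _ NH _ _ _
  isOpen_Hodot₂ := BiKummerSetting.isOpen_Hodot_mkOfConnectedTemperoid X _ _ _ NH _ _ _
  Ψ := CategoryTheory.Equivalence.refl
  Ψbs := CategoryTheory.Equivalence.refl
  comm := (setting U hU X R S NH M).base.rightUnitor ≪≫ (setting U hU X R S NH M).base.leftUnitor.symm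
  mapsAodot := ⟨Iso.refl _⟩

/-- **Non-vacuity of `Thm44Hyp` at constructed data** (for every `X`, `M`, `NH`, `R`, `S`). [cite: MochizukiEtTh2009, Thm 4.4 p.93] -/
theorem nonempty_thm44Hyp : Nonempty (BiKummerSetting.Thm44Hyp (setting U hU X R S NH M) (setting U hU X R S NH M)) :=
  ⟨thm44Hyp U hU X R S NH M⟩

/-- **[EtTh] Thm. 4.4 (i) FIRES at constructed data, for EVERY `(N, H)`-slot** — abc-iut-w5-d179's
`thm44_i_mkOfConnectedTemperoid_of_baseInj_treeVocabWeak` (⇐ {hBD₁, hBD₂}) at the inhabited `Thm44Hyp`.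
[cite: MochizukiEtTh2009, Thm 4.4 (i) p.94] -/
theorem thm44_i_oneCompTempered : BiKummerSetting.Thm44_i (thm44Hyp U hU X R S NH M) :=
  (thm44Hyp U hU X R S NH M).thm44_i_mkOfConnectedTemperoid_of_baseInj_treeVocabWeak _ _ _ NH _ _ _ _ _ _ NH _ _ _
    (fun α => hBD U hU X R S α) fun α => hBD U hU X R S α

/-- T44-L03 at the identity (from `hBD`, abc-iut-w5-d179's closer). [cite: MochizukiEtTh2009, Thm 4.4 p.95] -/
theorem thm44Hyp_preservesFrobeniusStructure : (thm44Hyp U hU X R S NH M).PreservesFrobeniusStructure :=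
  (thm44Hyp U hU X R S NH M).preservesFrobeniusStructure_mkOfConnectedTemperoid_of_baseInj_treeVocabWeak _ _ _ NH _ _ _ _ _ _
    NH _ _ _ (fun α => hBD U hU X R S α) fun α => hBD U hU X R S α

/-- The `ψ`-slot of Thm. 4.4 (ii)(iii): abc-iut-w5-d179's `psiModel` at the identity. [cite: MochizukiEtTh2009, Thm 4.4 p.94] -/
abbrev ψ (A : (setting U hU X R S NH M).C) :
    (setting U hU X R S NH M).biratUnits A ≃* (setting U hU X R S NH M).biratUnits ((thm44Hyp U hU X R S NH M).Ψ.functor.obj A) :=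
  (thm44Hyp U hU X R S NH M).psiModel (isFrobenioid_temperedFrobenioid U hU X R S) (isFrobenioid_temperedFrobenioid U hU X R S)
    (thm44Hyp_preservesFrobeniusStructure U hU X R S NH M) A

end OneCompTempered

namespace OneCompTempered

variable (U : Type) [CommGroup U] (hU : ∀ u : U, (∀ N : ℕ+, ∃ g : U, g ^ (N : ℕ) = u) → u = 1)
  {K : Type} [Field K] (X : SemiGraphs.TemperedArithmeticGroup.{0} K)
  (R S : ((ConnectedPart (BTemp X.Pi))ᵒᵖ ⥤ CommMonCat.{0}) → Prop) (M : OpenNormalSubgroup X.Pi)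

/-- The TRIVIAL `(N, H)`-slot (`True`). [cite: MochizukiEtTh2009, Def 4.1 p.87] -/
abbrev trivNH : Subgroup (Field.absoluteGaloisGroup K) → (temperedFrobenioid U hU X R S).category → ℕ+ → Prop :=
  fun _ _ _ => True

/-- T44-L15b at the identity with the trivial `(N, H)`-slot: tautological. [cite: MochizukiEtTh2009, Thm 4.4 p.95] -/
theorem thm44Hyp_preservesNHSaturatedBsFld_trivNH :
    (thm44Hyp U hU X R S (trivNH U hU X R S) M).PreservesNHSaturatedBsFld :=
  fun _ _ _ _ _ => Iff.rfl

/-- **[EtTh] Thm. 4.4 (i) ∧ (ii) ∧ (iii)-saturation ∧ N-th roots FIRE at constructed data** (trivial `(N, H)`-slot) — abc-iut-w5-d179's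
`thm44_mkOfConnectedTemperoid_of_baseInj_treeVocabWeak'` (⇐ {hBD₁, hBD₂, T44-L15b}, all three PROVED here).
[cite: MochizukiEtTh2009, Thm 4.4 p.94] -/
theorem thm44_oneCompTempered_trivNH :
    BiKummerSetting.Thm44_i (thm44Hyp U hU X R S (trivNH U hU X R S) M) ∧
      BiKummerSetting.Thm44_ii (thm44Hyp U hU X R S (trivNH U hU X R S) M) (ψ U hU X R S (trivNH U hU X R S) M) ∧
      BiKummerSetting.Thm44_iii (thm44Hyp U hU X R S (trivNH U hU X R S) M) (ψ U hU X R S (trivNH U hU X R S) M) ∧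
      (thm44Hyp U hU X R S (trivNH U hU X R S) M).PreservesNthRoots (ψ U hU X R S (trivNH U hU X R S) M)
        (fun φ f => (temperedFrobenioid U hU X R S).pullFracModel φ f)
        fun φ f => (temperedFrobenioid U hU X R S).pullFracModel φ f :=
  (thm44Hyp U hU X R S (trivNH U hU X R S) M).thm44_mkOfConnectedTemperoid_of_baseInj_treeVocabWeak' _ _ _ _ _ _ _ _ _ _ _ _ _ _
    (fun α => hBD U hU X R S α) (fun α => hBD U hU X R S α) (thm44Hyp_preservesNHSaturatedBsFld_trivNH U hU X R S M)

/-- The ROOTS READING of the `(N, H)`-slot (abc-iut-w4-d044): "every unit of `B(A_⊙)` with trivial divisor has an `M`-th root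
over `A`". [cite: MochizukiEtTh2009, Def 4.1 p.87] -/
abbrev rootsNH : Subgroup (Field.absoluteGaloisGroup K) → (temperedFrobenioid U hU X R S).category → ℕ+ → Prop :=
  fun _ A N => ∀ (g : A.base ⟶ ((temperedFrobenioid U hU X R S).connQuotZeroObj M).base)
    (x : (temperedFrobenioid U hU X R S).ratFnFunctor.obj (op ((temperedFrobenioid U hU X R S).connQuotZeroObj M).base)),
    divB (temperedFrobenioid U hU X R S).divisorMonoid (temperedFrobenioid U hU X R S).ratFnFunctor
        (temperedFrobenioid U hU X R S).divBNatTrans (op ((temperedFrobenioid U hU X R S).connQuotZeroObj M).base) x = 1 →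
      ∃ ζ : (temperedFrobenioid U hU X R S).ratFnFunctor.obj (op A.base),
        ζ ^ (N : ℕ) = pull (temperedFrobenioid U hU X R S).ratFnFunctor g x

/-- **[EtTh] Thm. 4.4 (i) ∧ (ii) ∧ (iii)-saturation ∧ N-th roots FIRE at constructed data AT THE ROOTS READING** of the
`(N, H_⊙^{bs-fld})`-slot — abc-iut-w5-d179's `thm44_mkOfConnectedTemperoid_rootsReading_of_baseInj_treeVocabWeak` (⇐ {hBD₁, hBD₂}
and NOTHING ELSE; T44-L15b by abc-iut-w4-d044's `preservesNHSaturatedBsFld_rootsReading`). [cite: MochizukiEtTh2009, Thm 4.4 p.94] -/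
theorem thm44_oneCompTempered_rootsNH :
    BiKummerSetting.Thm44_i (thm44Hyp U hU X R S (rootsNH U hU X R S M) M) ∧
      BiKummerSetting.Thm44_ii (thm44Hyp U hU X R S (rootsNH U hU X R S M) M) (ψ U hU X R S (rootsNH U hU X R S M) M) ∧
      BiKummerSetting.Thm44_iii (thm44Hyp U hU X R S (rootsNH U hU X R S M) M) (ψ U hU X R S (rootsNH U hU X R S M) M) ∧
      (thm44Hyp U hU X R S (rootsNH U hU X R S M) M).PreservesNthRoots (ψ U hU X R S (rootsNH U hU X R S M) M)
        (fun φ f => (temperedFrobenioid U hU X R S).pullFracModel φ f)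
        fun φ f => (temperedFrobenioid U hU X R S).pullFracModel φ f :=
  (thm44Hyp U hU X R S (rootsNH U hU X R S M) M).thm44_mkOfConnectedTemperoid_rootsReading_of_baseInj_treeVocabWeak
    _ _ _ _ _ _ _ _ _ _ _ _ (isFrobenioid_temperedFrobenioid U hU X R S) (isFrobenioid_temperedFrobenioid U hU X R S)
    (thm44Hyp_preservesFrobeniusStructure U hU X R S _ M) (fun α => hBD U hU X R S α) fun α => hBD U hU X R S α

end OneCompTempered

end Literature.AnabelianGeometry.EtaleTheta

end
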